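import Mathlib
import Summits.Ventures.HodgeRepro.Tier4.Common.Geometry

/-!
# Tier4/Common/Isotypic — «for some choice of the Hecke translates»: the isotypic pieces of `H^{1,0}(X)` and the
reduction of (P) to the four-linear pairing on them

Blind re-derivation cell `pub-hodge-repro`, Tier 4 (README §9–§10), seat t4-typer-1 (gen 0).  Target tree path
`lean/Summits/Ventures/HodgeRepro/Tier4/Common/Isotypic.lean`.  Imports `Tier4/Common/Geometry.lean` (the witness
`X`, its Hecke translates, the corner forms, `f^*Ω_s`, `f^*Ω_{s̄}`, `Witness.P`).

WHAT IS TYPED.  The holomorphic `1`-forms of `X` decompose under the Hecke algebra into isotypic pieces indexed by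
the conjugate-symplectic `U(1)`-characters of weight one (Liu 2021, Prop 4.13: `H^1_{B,τ′}(A_∞, ℂ) ≅ ⊕ ω(μ, ε, ν)`
as `ℂ[U(𝔸_F^∞)]`-modules — the printed statement is typed by t4-lit-5; here only its SHAPE is used): the corner
form `omega i` lies in the piece `piece i` of its character `μ_i`, the piece is stable under the Hecke translates,
and — the piece being an irreducible module over the Hecke algebra of the level — it is SPANNED by the Hecke
translates of any of its non-zero vectors, in particular by those of `omega i` (`span_translates`).  `Isotypic W`
records these four facts as fields over a witness `W`.

THE REDUCTION (`Witness.P_of_isotypic`): the function `(a, b, c, d) ↦ ⟨a ∧ b, c ∧ d⟩_{L²(X)}` is ℂ-linear in `a, b, c`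
and conjugate-linear in `d`; if it vanished on every quadruple of Hecke translates `(T_0^*ω_0, T_1^*ω_1, T_2^*ω_2,
T_3^*ω_3)` it would vanish on the spans, i.e. on `piece 0 × piece 1 × piece 2 × piece 3`.  Hence «for some choice of
the Hecke translates, ⟨f^*Ω_s, f^*Ω_{s̄}⟩ ≠ 0» FOLLOWS from «the pairing `⟨a ∧ b, c ∧ d⟩` is not identically zero on
the four isotypic pieces» — the whole content of the quantifier «for some choice of the Hecke translates» is this
span argument (the Jacobson-density form of the same step is landed as `HodgeRepro.T3P1.exists_smul_pairing_ne_zero`,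
Tier3HeckeIsolation).  The converse (`isotypic_pairing_of_P`) is immediate.  Nothing here decides whether the
four-linear pairing IS non-zero: that is the mathematics of the lines.

WHAT AN INTERFACE CAN AND CANNOT SAY.  Every field is a parameter; a theorem proved over these structures is a
theorem about every instantiation and exactly as strong as the listed properties.  Nothing here says anything about
the status of the Hodge conjecture for CM abelian varieties, which is NOT proved (HC_CM is NOT proved by anyone in
this repository).
-/

set_option autoImplicit false

noncomputable section

namespace Summit.Ventures.HodgeRepro.Tier4.Common

open Submodule

/-- **The isotypic pieces of the four corner forms** (Liu 2021 Prop 4.13, shape only): `piece i ⊆ H^{1,0}(X)` is the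
summand `ω(μ_i)` of the `U(1)`-character `μ_i` of the corner `i`; it contains `omega i`, is stable under the Hecke
translates, and is spanned by the Hecke translates of `omega i` (irreducibility over the Hecke algebra of the level). -/
structure Isotypic {Form : Type} [AddCommGroup Form] [Module ℂ Form] {A : FormAlgebra Form} (W : Witness A) where
  /-- the isotypic piece `ω(μ_i) ⊆ H^{1,0}(X)` of the corner `i` -/
  piece : Fin 4 → Submodule ℂ Form
  /-- the pieces consist of holomorphic `1`-forms -/
  piece_le : ∀ i : Fin 4, piece i ≤ A.H10
  /-- the corner form lies in its piece -/
  omega_mem_piece : ∀ i : Fin 4, W.omega i ∈ piece i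
  /-- the pieces are stable under the Hecke translates -/
  piece_stable : ∀ (i : Fin 4) (T : W.Hecke) (α : Form), α ∈ piece i → W.translate T α ∈ piece i
  /-- the Hecke translates of `omega i` span the piece (irreducibility of `ω(μ_i)` under the Hecke algebra) -/
  span_translates : ∀ i : Fin 4, piece i = span ℂ (Set.range fun T : W.Hecke => W.translate T (W.omega i))

/-- **The four-linear pairing** `(a, b, c, d) ↦ ⟨a ∧ b, c ∧ d⟩_{L²(X)}` on the forms of `X`. -/
def FormAlgebra.quadPairing {Form : Type} [AddCommGroup Form] [Module ℂ Form] (A : FormAlgebra Form)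
    (a b c d : Form) : ℂ := A.hodge (A.wedge a b) (A.wedge c d)

namespace Witness

variable {Form : Type} [AddCommGroup Form] [Module ℂ Form] {A : FormAlgebra Form} (W : Witness A)

/-- The Hodge pairing of (P) is the four-linear pairing at the four translated corner forms. -/
theorem hodgePairing_eq_quadPairing (γ : W.Translates) :
    W.hodgePairing γ =
      A.quadPairing (W.pullOmega γ 0) (W.pullOmega γ 1) (W.pullOmega γ 2) (W.pullOmega γ 3) := rfl

/-- The set of Hecke translates of the corner form `i`. -/
def translateSet (i : Fin 4) : Set Form := Set.range fun T : W.Hecke => W.translate T (W.omega i)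

/-- If the four-linear pairing vanishes on all quadruples of Hecke translates of the corner forms, it vanishes on
all quadruples of the spans of the translates (linearity in the first three slots, conjugate-linearity in the
fourth). -/
theorem quadPairing_eq_zero_of_forall_translates
    (h : ∀ T₀ T₁ T₂ T₃ : W.Hecke,
      A.quadPairing (W.translate T₀ (W.omega 0)) (W.translate T₁ (W.omega 1))
        (W.translate T₂ (W.omega 2)) (W.translate T₃ (W.omega 3)) = 0)
    {a b c d : Form} (ha : a ∈ span ℂ (W.translateSet 0)) (hb : b ∈ span ℂ (W.translateSet 1))
    (hc : c ∈ span ℂ (W.translateSet 2)) (hd : d ∈ span ℂ (W.translateSet 3)) :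
    A.quadPairing a b c d = 0 := by
  unfold FormAlgebra.quadPairing at *
  -- slot `a` (ℂ-linear)
  induction ha using span_induction with
  | mem x hx =>
    obtain ⟨T₀, rfl⟩ := hx
    -- slot `b` (ℂ-linear)
    induction hb using span_induction with
    | mem y hy =>
      obtain ⟨T₁, rfl⟩ := hy
      -- slot `c` (ℂ-linear)
      induction hc using span_induction with
      | mem z hz =>
        obtain ⟨T₂, rfl⟩ := hz
        -- slot `d` (conjugate-linear)
        induction hd using span_induction with
        | mem w hw =>
          obtain ⟨T₃, rfl⟩ := hw
          exact h T₀ T₁ T₂ T₃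
        | zero => simp
        | add w w' _ _ ihw ihw' => rw [map_add, map_add, ihw, ihw', add_zero]
        | smul r w _ ihw => rw [map_smul, LinearMap.map_smulₛₗ, ihw, smul_zero]
      | zero => simp
      | add z z' _ _ ihz ihz' => rw [map_add, LinearMap.add_apply, map_add, ihz, ihz', add_zero]
      | smul r z _ ihz => rw [map_smul, LinearMap.smul_apply, LinearMap.map_smulₛₗ, ihz, smul_zero]
    | zero => simp
    | add y y' _ _ ihy ihy' => rw [map_add, map_add, LinearMap.add_apply, ihy, ihy', add_zero]
    | smul r y _ ihy => rw [map_smul, map_smul, LinearMap.smul_apply, ihy, smul_zero]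
  | zero => simp
  | add x x' _ _ ihx ihx' => rw [map_add, LinearMap.add_apply, map_add, LinearMap.add_apply, ihx, ihx', add_zero]
  | smul r x _ ihx => rw [map_smul, LinearMap.smul_apply, map_smul, LinearMap.smul_apply, ihx, smul_zero]

/-- **THE REDUCTION.**  If the four-linear pairing `⟨a ∧ b, c ∧ d⟩` is not identically zero on the four isotypic
pieces, then (P) holds: for some choice of the Hecke translates `⟨f^*Ω_s, f^*Ω_{s̄}⟩_{L²(X)} ≠ 0`. -/
theorem P_of_isotypic (I : Isotypic W)
    (h : ∃ a ∈ I.piece 0, ∃ b ∈ I.piece 1, ∃ c ∈ I.piece 2, ∃ d ∈ I.piece 3, A.quadPairing a b c d ≠ 0) :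
    W.P := by
  obtain ⟨a, ha, b, hb, c, hc, d, hd, hne⟩ := h
  by_contra hP
  apply hne
  have hall : ∀ T₀ T₁ T₂ T₃ : W.Hecke,
      A.quadPairing (W.translate T₀ (W.omega 0)) (W.translate T₁ (W.omega 1))
        (W.translate T₂ (W.omega 2)) (W.translate T₃ (W.omega 3)) = 0 := by
    intro T₀ T₁ T₂ T₃
    by_contra hT
    exact hP ⟨![T₀, T₁, T₂, T₃], by
      rw [hodgePairing_eq_quadPairing]
      simpa [pullOmega] using hT⟩
  rw [I.span_translates 0] at ha
  rw [I.span_translates 1] at hb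
  rw [I.span_translates 2] at hc
  rw [I.span_translates 3] at hd
  exact W.quadPairing_eq_zero_of_forall_translates hall ha hb hc hd

/-- Conversely, (P) gives a non-zero value of the four-linear pairing on the four pieces (the translated corner
forms lie in the pieces). -/
theorem isotypic_pairing_of_P (I : Isotypic W) (hP : W.P) :
    ∃ a ∈ I.piece 0, ∃ b ∈ I.piece 1, ∃ c ∈ I.piece 2, ∃ d ∈ I.piece 3, A.quadPairing a b c d ≠ 0 := by
  obtain ⟨γ, hγ⟩ := hP
  refine ⟨W.pullOmega γ 0, I.piece_stable 0 _ _ (I.omega_mem_piece 0),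
    W.pullOmega γ 1, I.piece_stable 1 _ _ (I.omega_mem_piece 1),
    W.pullOmega γ 2, I.piece_stable 2 _ _ (I.omega_mem_piece 2),
    W.pullOmega γ 3, I.piece_stable 3 _ _ (I.omega_mem_piece 3), ?_⟩
  rw [← hodgePairing_eq_quadPairing]
  exact hγ

/-- (P) ⟺ the four-linear pairing is not identically zero on the four isotypic pieces. -/
theorem P_iff_isotypic (I : Isotypic W) :
    W.P ↔ ∃ a ∈ I.piece 0, ∃ b ∈ I.piece 1, ∃ c ∈ I.piece 2, ∃ d ∈ I.piece 3, A.quadPairing a b c d ≠ 0 :=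
  ⟨W.isotypic_pairing_of_P I, W.P_of_isotypic I⟩

end Witness

end Summit.Ventures.HodgeRepro.Tier4.Common
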